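import Literature.MathematicalPhysics.QuantumFieldTheory.Balaban1983to89.B8FlatBondCalculusZd

/-!
# `Balaban1983to89.B8Ineq159FlatCubeMemberKernel` — KERNEL CERTIFICATE: THE REPAIRED FLAT (1.59) DATA OVER PRINT'S CLASS `cubeLamBP` DETERMINE
# THE FIELD — at every cube member `{□_j}` of [Balaban1985RegularSpaces] (1.131) (`k ≥ 1`), every truncation `1 ≤ m ≤ k`, every `η > 0`, `d ≥ 2`:
# a ℂ-valued bond function in the flat Landau gauge (1.38) (multiplier form of record) supported on the bonds touching `□₀`, with current
# `J = D^{η*}_1D^η_1φ = 0` on those bonds and ZERO un-normalised flat averages `Lʲη·Q_j(1)(iηφ)` on EVERY bond of print's class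
# `B8Ineq159FlatCubeMemberPrinted.cubeLamBP … m j`, `j ≤ m` (inner AND crossing bonds, [B6] (2.3) ∕ (1.31)), is IDENTICALLY ZERO —
# [B6] (2.11) «Δ is positive on N(Q′), hence it is invertible» for the operator of (1.58) at `U₀ = 1` on the cube member

statement-level skeleton of published theorems with citation tags; proofs where landed; nothing here is a claim about the
Yang–Mills mass gap

`[Balaban1985RegularSpaces]` ("B8", CMP **99** (1985) 75–102) (1.31) p. 82, (1.38) p. 82, (1.55) p. 86, (1.58)–(1.59) p. 86, (1.62) p. 87,
(1.131) p. 99; `[Balaban1984PropagatorsII]` ("B6", CMP **96** (1984) 223–250) (2.3) p. 224, (2.7) p. 224, (2.10)–(2.12) p. 225;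
`[Balaban1985BackgroundPropagators]` ("[4]", CMP **99** (1985) 389–434) (3.4) p. 391, (3.9)–(3.10) p. 392, (3.19) p. 393, (3.23)–(3.25) p. 394,
Thm 3.3 p. 399; `[Balaban1985Averaging]` ("B7") (122) + (125) p. 36, (127) p. 37.

CITATION HEADER (lean-in-tree rule).  Cell `pub-ymgap` (YM Track A, HUMAN RULING D-0062 ∕ D-0149), DAG node N05 = [B8], width seat
`pub-ymgap-dag-n05-w3` (g0), CLAIM-2 ∕ INTENT-2 (bus 2026-08-27 22:52Z; dag-lead DEDUP-354 GO; dag-n05-c g12 «T1 identities + kernel-zero are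
yours»).  WHY.  dag-n05-c certified that the β-edition flat (1.59) clauses over the TYPED bond class `cubeLamB` are false at every nested cube
member — one interior shell gauge mode per level (`B8Ineq159FlatShellModeVacuity`, p572834) —, typed PRINT's class `cubeLamBP` and the repaired
named target `Ineq159FlatCubeMemberPrinted` (p573921), and certified that THOSE shell modes carry a non-zero datum on the repaired class
(`B8Ineq159FlatShellModeCrossingDatum`, p578369).  THIS FILE closes the question for ALL candidate zero modes: with the data of the repaired
statement set to zero the field vanishes.  Consequences: (a) the hypotheses of `Ineq159FlatCubeMemberPrinted` at `N = 0` pin `φ = 0`, so at every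
FIXED cube member the three conclusions hold for SOME finite `B₀` (finite-dimensional inhabitant — the A6 question for the repaired flat road; the
UNIFORM `B₀(d, L)` of p573921 is the transplant T2–T4 of dag-n05-c's `TRANSPLANT-DESIGN.md`, open); (b) the kernel of the flat operator of (1.58)
restricted to the Landau gauge of record with Dirichlet exterior on `□₀` and constraints over print's class is trivial — [B6] (2.11) at the member.

THE MATHEMATICS (kernel-checked; flat background, `Site d = ℤᵈ`).  Let `□_j = cube L a M ρ k j`, `Λ′_j = cubeLam … j`, truncation `m`.
* §1 ★ `ray_escape` (lattice combinatorics): if `T : ℤᵈ → ℂ` vanishes off a box `[lo, hi]` and is constant across every bond of «print's class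
  relative to an inner box `[ilo, ihi]`» (at least one end in `[lo, hi]`, no end in `[ilo, ihi]`), then `T = 0` off the inner box — walk along
  `±e_i` away from the inner box until the CROSSING bond leaves `[lo, hi]`.
* §2 cube-member geometry: `□₀ = [sqLo₀, sqHi₀]` (`Iff.rfl`), `□₁ = B(□₁^{(1)})` at level `0`, a level-`j` site inside `□_{j+1}^{(j)}` has its
  `L`-block index inside `□_{j+1}^{(j+1)}` (`inBox_sq_succ_blockMap_of_inBox_in`), block nesting of the `Lʲ`-block sums.
* §3 ★★ `blockSum_eq_zero_of_classData`: if `λ` vanishes off `□₀` and its `Lʲ`-block sums agree across every bond of `cubeLamBP … m j`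
  (`j ≤ m`), then for every `j ≤ m` the `Lʲ`-block sum of `λ` vanishes at every level-`j` site outside `□_{j+1}^{(j)}` (no restriction at `j = m`):
  induction on `j`, §1 at each level, the blocks of a site outside `□_{j+1}^{(j+1)}` being made of level-`j` sites outside `□_{j+1}^{(j)}`.
  In particular `λ = 0` on `Λ′₀` and `Q′_jλ = 0` on `Λs m j`, `1 ≤ j ≤ m`: `λ ∈ N(Q′)` ([B6] (2.7)).
* §4 ★★★ `eq_zero_of_ineq159FlatData_eq_zero` — assembly: (i) `φ̄·J = 0` at every bond (support ∕ current hypotheses) ⇒ `D^η_1φ ≡ 0`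
  (`B8FlatBondCalculusZd.plaqCovDeriv_eq_zero_of_conj_mul_Jcur_eq_zero`); (ii) Poincaré lemma (`…exists_eq_covDerivFwd_of_plaqCovDeriv_eq_zero`):
  `φ = D^η_1λ`, `λ` supported in `□₀`; (iii) the class data are `i·L^{−jd}·(block-sum differences)` (`…linCovIter_one_grad`) ⇒ §3 ⇒ `λ̄ ∈ N(Q′)`;
  (iv) dag-n05-c's `B8Eq138LandauFlatOrthogonal.pairing_covLap_eq_zero_of_isLandau138` with the gauge function `λ̄`: `Σ_{□₀}|Δ^η_1λ|² = 0`, so `λ` is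
  Dirichlet-harmonic on `□₀` and zero outside, so (`B8Ineq159FlatShellModeCrossingDatum.shift_eq_of_finsum_conj_mul_covLap_self_eq_zero`) translation
  invariant and finitely supported: `λ = 0`, `φ = 0`.

HONEST SCOPE.  A uniqueness ∕ injectivity certificate for the repaired typed target (lattice calculus + combinatorics + [B6] (2.11)'s positivity);
NO estimate with constants — `Ineq159FlatCubeMemberPrinted` (uniform `B₀`) stays OPEN; nothing of Bałaban's analysis asserted beyond the
elementary positivity; count-neutral; N05 NOT discharged; no count claim; one finite `T⁴` programme at fixed `ε`, Bałaban as printed; the YM mass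
gap (Clay) is NOT proved by any of this — R4 closes the conditional finite-`𝕋⁴` rung `BalabanLadder.UV` only; nothing continuum ∕ ℝ⁴ ∕ OS.
No `sorry`, no `def`, no `instance`, no `notation`.  Unit `pub-ymgap-dag-n05-w3` (g0), 2026-08-27.
-/

noncomputable section

open ComplexConjugate

namespace Literature.MathematicalPhysics.QuantumFieldTheory.Balaban1983to89.B8Ineq159FlatCubeMemberKernel

open B7Prop1Explicit B7Prop2Explicit B7Prop1Local
open B7Prop4GeneralLevels (linCovIter)
open B8Ineq132 (covDerivFwd BondTouches Under)
open B8Eq146AExpansion (iEta plaqCovDeriv)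
open B8Eq155JBound (Jcur)
open B8Eq138LandauZd (IsLandau138 covLap covDivB)
open B8Eq131Cubes (cube sqLo sqHi inLo inHi mem_cube_iff)
open B8Eq131CubesAdmissible (cubeFam cubeFam_false_zero smul_mem_cube_iff smul_mem_cube_succ_iff)
open B8CubeMemberZd (cubeLam cubeLamS mem_cubeLam_zero_iff cubeLamS_of_lt cubeLamS_self)
open B8Ineq159FlatCubeMemberPrinted (cubeLamBP)
open B8Eq191FlatStencils (covDerivFwd_flat_apply covLap_flat_apply)
open B8Eq191FlatLettersCubeMember (inBox_finite under_iff_blockMap_eq under_smul_self)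
open B8FlatBondCalculusZd (not_inBox_of_hi_lt not_inBox_of_lt_lo sum_blockSites_one
  plaqCovDeriv_eq_zero_of_conj_mul_Jcur_eq_zero exists_eq_covDerivFwd_of_plaqCovDeriv_eq_zero linCovIter_one_grad)
open B8Ineq159FlatShellModeCrossingDatum (eq_zero_of_finsum_conj_mul_self_eq_zero shift_eq_of_finsum_conj_mul_covLap_self_eq_zero
  support_covLap_finite)
open B8Eq138LandauFlatOrthogonal (pairing_covLap_eq_zero_of_isLandau138)
open Literature.MathematicalPhysics.QuantumLattice (blockMap blockSites mem_blockSites_iff)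

export B7Prop1Explicit (Site)

variable {d : ℕ}

/-! ## §1 Ray escape: a function constant across print's class and zero outside the outer box vanishes outside the inner box -/

/-- `(x − e_μ)_i = x_i − [i = μ]`. [folklore] -/
private theorem sub_e_apply (x : Site d) (μ i : Fin d) : (x - e μ) i = x i - (if i = μ then 1 else 0) := by
  have := add_zsmul_e_apply x (-1) μ i
  rw [neg_one_smul, ← sub_eq_add_neg] at this
  rw [this]; split_ifs <;> ring

/-- ★ **RAY ESCAPE** (the combinatorial heart of [B6] (2.3)'s crossing bonds): let `T : ℤᵈ → ℂ` vanish at every site outside the box `[lo, hi]`,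
and suppose `T(w + e_i) = T(w)` for every lattice bond `⟨w, w + e_i⟩` with AT LEAST ONE end in `[lo, hi]` and NO end in the inner box `[ilo, ihi]`
(print's class at one level: inner bonds of the layer AND the bonds sticking out of the outer box).  Then `T(w) = 0` for every `w` outside the inner
box: from such a `w` walk in a direction `±e_i` in which a coordinate already violates the inner box — the walk never meets the inner box and its
last bond CROSSES the boundary of `[lo, hi]`. [cite: Balaban1984PropagatorsII, (2.3) p.224, (2.7) p.224; Balaban1985RegularSpaces, (1.31) p.82] -/
theorem ray_escape {lo hi ilo ihi : Site d} {T : Site d → ℂ} (hout : ∀ w, ¬ InBox lo hi w → T w = 0)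
    (hbond : ∀ (w : Site d) (i : Fin d), (InBox lo hi w ∨ InBox lo hi (w + e i)) →
      ¬ InBox ilo ihi w → ¬ InBox ilo ihi (w + e i) → T (w + e i) = T w) :
    ∀ w, ¬ InBox ilo ihi w → T w = 0 := by
  -- walking up in direction `i`
  have hup : ∀ (i : Fin d) (n : ℕ) (v : Site d), ihi i < v i → (hi i + 1 - v i).toNat = n → T v = 0 := by
    intro i n
    induction n with
    | zero =>
      intro v _ hn
      exact hout v (not_inBox_of_hi_lt (i := i) (by omega))
    | succ n ih =>
      intro v hv hn
      by_cases hbox : InBox lo hi v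
      · have h1 : ihi i < (v + e i) i := by rw [add_e_apply, if_pos rfl]; omega
        rw [← hbond v i (Or.inl hbox) (not_inBox_of_hi_lt hv) (not_inBox_of_hi_lt h1)]
        exact ih (v + e i) h1 (by rw [add_e_apply, if_pos rfl]; omega)
      · exact hout v hbox
  -- walking down in direction `i`
  have hdown : ∀ (i : Fin d) (n : ℕ) (v : Site d), v i < ilo i → (v i + 1 - lo i).toNat = n → T v = 0 := by
    intro i n
    induction n with
    | zero =>
      intro v _ hn
      exact hout v (not_inBox_of_lt_lo (i := i) (by omega))
    | succ n ih =>
      intro v hv hn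
      by_cases hbox : InBox lo hi v
      · have h1 : (v - e i) i < ilo i := by rw [sub_e_apply, if_pos rfl]; omega
        have h2 := hbond (v - e i) i (Or.inr (by rwa [sub_add_cancel])) (not_inBox_of_lt_lo h1)
          (by rw [sub_add_cancel]; exact not_inBox_of_lt_lo hv)
        rw [sub_add_cancel] at h2
        rw [h2]
        exact ih (v - e i) h1 (by rw [sub_e_apply, if_pos rfl]; omega)
      · exact hout v hbox
  intro w hw
  have hw' : ∃ i, w i < ilo i ∨ ihi i < w i := by
    by_contra h
    push Not at h
    exact hw fun i => ⟨(h i).1, (h i).2⟩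
  obtain ⟨i, hi | hi⟩ := hw'
  · exact hdown i _ w hi rfl
  · exact hup i _ w hi rfl

/-! ## §2 Cube-member geometry: `□₀` as a box, the inner boxes one level up, block nesting -/

/-- `□₀` IS the box `[sqLo₀, sqHi₀]` of the fine lattice (`tlo … 0`, `thi … 0` are the identity). [cite: Balaban1985RegularSpaces, (1.131) p.99, p.98] -/
theorem mem_cube_zero_iff (L : ℕ) (a : Site d) (M ρ k : ℕ) (x : Site d) :
    x ∈ cube L a M ρ k 0 ↔ InBox (sqLo L a ρ k 0) (sqHi L a M ρ k 0) x := Iff.rfl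

/-- At level `0` the inner box `[inLo₀, inHi₀]` is `□₁` traced on the fine lattice (`k ≥ 1`). [cite: Balaban1985RegularSpaces, (1.131) p.99] -/
theorem inBox_in_zero_iff {L : ℕ} (hL : 1 ≤ L) (a : Site d) (M ρ : ℕ) {k : ℕ} (hk : 1 ≤ k) (x : Site d) :
    InBox (inLo L a ρ k 0) (inHi L a M ρ k 0) x ↔ x ∈ cube L a M ρ k 1 := by
  have := smul_mem_cube_succ_iff hL a M ρ (show 0 < k by omega) x
  rw [pow_zero, one_smul] at this
  exact this.symm

/-- `blockMap (Lʲ) (Lʲ•y) = y`. [folklore] [cite: Balaban1985RegularSpaces, p.79 («x₀ ∈ Bʲ(x_j)»)] -/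
theorem blockMap_pow_smul_self {L : ℕ} (hL : 1 ≤ L) (j : ℕ) (y : Site d) : blockMap (L ^ j) (((L : ℤ) ^ j) • y) = y :=
  (under_iff_blockMap_eq hL j y _).1 (under_smul_self hL j y)

/-- ★ **A level-`j` site inside `□_{j+1}^{(j)}` has its `L`-block index inside `□_{j+1}^{(j+1)}`** (`j < k`; block compatibility of the cubes, p. 98
«for every j the cube □_j is a sum of the big blocks»). [cite: Balaban1985RegularSpaces, p.98, (1.131) p.99] -/
theorem inBox_sq_succ_blockMap_of_inBox_in {L : ℕ} (hL : 1 ≤ L) (a : Site d) (M ρ : ℕ) {k j : ℕ} (hj : j < k) {w : Site d}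
    (hw : InBox (inLo L a ρ k j) (inHi L a M ρ k j) w) :
    InBox (sqLo L a ρ k (j + 1)) (sqHi L a M ρ k (j + 1)) (blockMap L w) := by
  have h1 := (smul_mem_cube_succ_iff hL a M ρ hj w).2 hw
  obtain ⟨z, hz, hu⟩ := (mem_cube_iff hL).1 h1
  have h2 : blockMap (L ^ (j + 1)) (((L : ℤ) ^ j) • w) = z := (under_iff_blockMap_eq hL (j + 1) z _).1 hu
  rw [pow_succ, ← B7BlockGeometry.blockMap_blockMap, blockMap_pow_smul_self hL] at h2
  rw [h2]; exact hz

/-- A site of the block `B(w)` has block index `w`. [cite: Balaban1985Averaging, (2) p.17] -/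
theorem blockMap_eq_of_mem_blockSites {L : ℕ} (hL : 1 ≤ L) {w w' : Site d} (h : w' ∈ blockSites L w) : blockMap L w' = w := by
  haveI : NeZero L := ⟨by omega⟩
  exact (mem_blockSites_iff L w w').1 h

/-- **Block nesting of the block sums**: `Σ_{x∈B^{j+1}(w)} λ(x) = Σ_{w′∈B(w)} Σ_{x∈Bʲ(w′)} λ(x)`. [cite: Balaban1985Averaging, (2)–(3) p.17] -/
theorem sum_blockSites_pow_succ {L : ℕ} (hL : 1 ≤ L) (j : ℕ) (w : Site d) (lam : Site d → ℂ) :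
    ∑ x ∈ blockSites (L ^ (j + 1)) w, lam x = ∑ w' ∈ blockSites L w, ∑ x ∈ blockSites (L ^ j) w', lam x := by
  rw [pow_succ, B7BlockGeometry.sum_blockSites_mul (L ^ j) L (by positivity) (by omega)]

/-! ## §3 Class data ⇒ the gauge function is in `N(Q′)` -/

/-- ★★ **ZERO CLASS DATA FORCE VANISHING BLOCK SUMS OFF THE INNER CUBES** ([B6] (2.7) via the crossing bonds of (2.3)): let `λ : ℤᵈ → ℂ` vanish
outside `□₀` and have, for every `j ≤ m` and every bond `c` of print's class `cubeLamBP … m j`, equal `Lʲ`-block sums at the two ends of `c`.  Then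
for every `j ≤ m` and every level-`j` site `w` that is NOT inside `□_{j+1}^{(j)}` when `j < m` (no restriction at the truncation level `j = m`):
`Σ_{x∈Bʲ(w)} λ(x) = 0`.  In particular `λ = 0` on `Λ′₀ = □₀ ∖ □₁` and `Q′_jλ = 0` on `Λs m j` for `1 ≤ j ≤ m`, i.e. `λ ∈ N(Q′)`.
Proof: induction on `j`; at each level `ray_escape`, the value outside `□_j^{(j)}` being zero because such a block is a union of level-`(j−1)`
blocks outside `□_j^{(j−1)}` (`inBox_sq_succ_blockMap_of_inBox_in`). [cite: Balaban1984PropagatorsII, (2.3) p.224, (2.7) p.224; Balaban1985RegularSpaces, (1.31) p.82, (1.131) p.99, (1.29) p.81] -/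
theorem blockSum_eq_zero_of_classData (hd : 1 ≤ d) {L : ℕ} (hL : 1 ≤ L) (a : Site d) (M ρ : ℕ) {k m : ℕ}
    (hm : m ≤ k) {lam : Site d → ℂ} (hout : ∀ x, x ∉ cube L a M ρ k 0 → lam x = 0)
    (hdata : ∀ j, j ≤ m → ∀ c ∈ cubeLamBP L a M ρ k m j,
      ∑ x ∈ blockSites (L ^ j) (c.1 + e c.2), lam x = ∑ x ∈ blockSites (L ^ j) c.1, lam x) :
    ∀ j, j ≤ m → ∀ w : Site d, (j < m → ¬ InBox (inLo L a ρ k j) (inHi L a M ρ k j) w) →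
      ∑ x ∈ blockSites (L ^ j) w, lam x = 0 := by
  -- an empty «inner box» for the truncation level
  have hempty : ∀ w : Site d, ¬ InBox (fun _ => (1 : ℤ)) (fun _ => (0 : ℤ)) w := by
    intro w h
    have := h ⟨0, by omega⟩
    dsimp only at this
    omega
  -- one level of the induction, with the inner box `[ilo, ihi]` = `[inLo_j, inHi_j]` if `j < m`, empty if `j = m`
  have hlevel : ∀ j, j ≤ m → ∀ (ilo ihi : Site d),
      (∀ w, InBox ilo ihi w ↔ (j < m ∧ InBox (inLo L a ρ k j) (inHi L a M ρ k j) w)) →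
      (∀ w, ¬ InBox (sqLo L a ρ k j) (sqHi L a M ρ k j) w → ∑ x ∈ blockSites (L ^ j) w, lam x = 0) →
      ∀ w, ¬ InBox ilo ihi w → ∑ x ∈ blockSites (L ^ j) w, lam x = 0 := by
    intro j hj ilo ihi hinner houtj
    refine ray_escape houtj fun w i hends h1 h2 => hdata j hj (w, i) ⟨hj, hends, fun hjm => ?_⟩
    exact ⟨fun h => h1 ((hinner w).2 ⟨hjm, h⟩), fun h => h2 ((hinner (w + e i)).2 ⟨hjm, h⟩)⟩
  -- the induction
  intro j
  induction j with
  | zero =>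
    intro hj w hw
    rw [pow_zero, sum_blockSites_one]
    have hout0 : ∀ w, ¬ InBox (sqLo L a ρ k 0) (sqHi L a M ρ k 0) w → ∑ x ∈ blockSites (L ^ 0) w, lam x = 0 := by
      intro w hw
      rw [pow_zero, sum_blockSites_one]
      exact hout w hw
    by_cases hm0 : 0 < m
    · have := hlevel 0 hj (inLo L a ρ k 0) (inHi L a M ρ k 0) (fun w => by simp [hm0]) hout0 w (hw hm0)
      rwa [pow_zero, sum_blockSites_one] at this
    · have := hlevel 0 hj (fun _ => 1) (fun _ => 0) (fun w => by simp [hm0, hempty w]) hout0 w (hempty w)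
      rwa [pow_zero, sum_blockSites_one] at this
  | succ j ih =>
    intro hj w hw
    have hjm : j < m := by omega
    have hjk : j < k := by omega
    -- outside `□_{j+1}^{(j+1)}` the `L^{j+1}`-block sum vanishes by the induction hypothesis
    have houtS : ∀ w, ¬ InBox (sqLo L a ρ k (j + 1)) (sqHi L a M ρ k (j + 1)) w →
        ∑ x ∈ blockSites (L ^ (j + 1)) w, lam x = 0 := by
      intro w hw
      rw [sum_blockSites_pow_succ hL]
      refine Finset.sum_eq_zero fun w' hw' => ih hjm.le w' fun _ hin => hw ?_
      have := inBox_sq_succ_blockMap_of_inBox_in hL a M ρ hjk hin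
      rwa [blockMap_eq_of_mem_blockSites hL hw'] at this
    by_cases hjm' : j + 1 < m
    · exact hlevel (j + 1) hj (inLo L a ρ k (j + 1)) (inHi L a M ρ k (j + 1)) (fun w => by simp [hjm']) houtS w (hw hjm')
    · exact hlevel (j + 1) hj (fun _ => 1) (fun _ => 0) (fun w => by simp [hjm', hempty w]) houtS w (hempty w)

/-! ## §4 The kernel theorem -/

/-- `Δ^η_1` commutes with complex conjugation (real stencil). [cite: Balaban1985BackgroundPropagators, (3.23) p.394] -/
theorem covLap_flat_conj (η : ℝ) (lam : Site d → ℂ) (x : Site d) :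
    covLap η (1 : Site d → Fin d → ℂˣ) (fun y => conj (lam y)) x = conj (covLap η (1 : Site d → Fin d → ℂˣ) lam x) := by
  rw [covLap_flat_apply, covLap_flat_apply, map_sum]
  refine Finset.sum_congr rfl fun μ _ => ?_
  simp only [Complex.real_smul, map_mul, map_sub, Complex.conj_ofReal]

/-- ★★★ **THE REPAIRED FLAT (1.59) DATA DETERMINE THE FIELD — KERNEL ZERO AT EVERY CUBE MEMBER.**  Let `d ≥ 2`, `L ≥ 1`, `η > 0`, a cube datum
`(a, M, ρ, k)` of (1.131) with `k ≥ 1`, a truncation `1 ≤ m ≤ k`, and a bond function `φ : ℤᵈ → (Fin d → ℂ)` such that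
(1) `φ` is in the flat Landau gauge of record, `IsLandau138 L m η □₀ (cubeLamS … m) 1 φ` ((1.38), multiplier form);
(2) `φ` vanishes on every bond not touching `□₀` (support ∕ exterior datum zero);
(3) the current vanishes on the bonds touching `□₀`: `J(φ) = D^{η*}_1D^η_1φ = 0` there ((1.55) datum zero);
(4) every un-normalised flat average over PRINT's class vanishes: `linCovIter L 1 (iηφ) j c = 0`, `c ∈ cubeLamBP … m j`, `j ≤ m` ((1.31) datum zero).
Then `φ = 0`.  Hence the hypotheses of `B8Ineq159FlatCubeMemberPrinted.Ineq159FlatCubeMemberPrinted` with `N = 0` force `φ = 0`: the repaired target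
has no zero mode (contrast: over the typed class `cubeLamB` the same data admit the shell modes of `B8Ineq159FlatShellModeVacuity`).
[cite: Balaban1984PropagatorsII, (2.11) p.225, (2.3) p.224, (2.7) p.224, (2.12) p.225; Balaban1985RegularSpaces, (1.58)–(1.59) p.86, (1.38) p.82, (1.31) p.82, (1.55) p.86, (1.131) p.99; Balaban1985BackgroundPropagators, (3.25) p.394, Thm 3.3 p.399] -/
theorem eq_zero_of_ineq159FlatData_eq_zero (hd2 : 2 ≤ d) {L : ℕ} (hL : 1 ≤ L) {η : ℝ} (hη : 0 < η) (a : Site d) (M ρ : ℕ)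
    {k m : ℕ} (hm1 : 1 ≤ m) (hmk : m ≤ k) {φ : Site d → Fin d → ℂ}
    (hLan : IsLandau138 L m η (cubeFam false L a M ρ k 0) (cubeLamS L a M ρ k m) (1 : Site d → Fin d → ℂˣ) φ)
    (hsupp : ∀ (y : Site d) (τ : Fin d), ¬ BondTouches (cubeFam false L a M ρ k 0) y τ → φ y τ = 0)
    (hJ : ∀ (y : Site d) (τ : Fin d), BondTouches (cubeFam false L a M ρ k 0) y τ →
      Jcur η (1 : Site d → Fin d → ℂˣ) φ τ y = 0)
    (hdata : ∀ j, j ≤ m → ∀ c ∈ cubeLamBP L a M ρ k m j,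
      linCovIter L (1 : Site d → Fin d → ℂˣ) (iEta η φ) j c.1 c.2 = 0) :
    φ = 0 := by
  classical
  have hd1 : 1 ≤ d := by omega
  have hk : 1 ≤ k := hm1.trans hmk
  set lo : Site d := sqLo L a ρ k 0 with hlo
  set hi : Site d := sqHi L a M ρ k 0 with hhi
  have hΩ0 : cubeFam false L a M ρ k 0 = {y | InBox lo hi y} := by
    rw [cubeFam_false_zero]; rfl
  have hΩfin : (cubeFam false L a M ρ k 0).Finite := by rw [hΩ0]; exact inBox_finite lo hi
  -- (0) the components of `φ` are supported in the finite box `[lo − 1, hi]`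
  have hφfin : ∀ τ, (Function.support fun x => φ x τ).Finite := by
    intro τ
    refine (inBox_finite (lo - 1) hi).subset fun x hx => ?_
    rw [Function.mem_support] at hx
    have hbt : BondTouches (cubeFam false L a M ρ k 0) x τ := by
      by_contra h; exact hx (hsupp x τ h)
    rw [hΩ0] at hbt
    intro i
    rcases hbt with h | h
    · have := h i; simp only [Pi.sub_apply, Pi.one_apply]; omega
    · have := h i
      rw [add_e_apply] at this
      simp only [Pi.sub_apply, Pi.one_apply]
      split_ifs at this <;> omega
  -- (i) `φ` is closed
  have hclosed : ∀ μ ν x, plaqCovDeriv η (1 : Site d → Fin d → ℂˣ) φ μ ν x = 0 := by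
    refine plaqCovDeriv_eq_zero_of_conj_mul_Jcur_eq_zero η hφfin fun x τ => ?_
    by_cases h : BondTouches (cubeFam false L a M ρ k 0) x τ
    · rw [hJ x τ h, mul_zero]
    · rw [hsupp x τ h, map_zero, zero_mul]
  -- (ii) Poincaré: `φ = D^η_1 λ`, `λ` supported in `□₀`
  obtain ⟨lam, hgrad, hlam0⟩ := exists_eq_covDerivFwd_of_plaqCovDeriv_eq_zero hd2 hη.ne' lo hi
    (φ := φ) (fun x τ h => hsupp x τ (by rwa [hΩ0])) hclosed
  have hφeq : φ = fun y τ => covDerivFwd η (1 : Site d → Fin d → ℂˣ) τ lam y := by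
    funext y τ; exact (hgrad y τ).symm
  have hlam_out : ∀ x, x ∉ cube L a M ρ k 0 → lam x = 0 := fun x hx => hlam0 x hx
  -- `λ` is bounded (finitely supported)
  have hlamfin : (Function.support lam).Finite := (inBox_finite lo hi).subset fun x hx => by
    by_contra h; exact hx (hlam0 x h)
  obtain ⟨Λ, hΛ⟩ : ∃ Λ : ℝ, ∀ x, ‖lam x‖ ≤ Λ := by
    refine ⟨∑ x ∈ hlamfin.toFinset, ‖lam x‖, fun x => ?_⟩
    by_cases hx : x ∈ hlamfin.toFinset
    · exact Finset.single_le_sum (f := fun x => ‖lam x‖) (fun _ _ => norm_nonneg _) hx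
    · rw [Set.Finite.mem_toFinset, Function.mem_support, not_not] at hx
      rw [hx, norm_zero]; exact Finset.sum_nonneg fun _ _ => norm_nonneg _
  -- (iii) the class data are block-sum differences
  have hdata' : ∀ j, j ≤ m → ∀ c ∈ cubeLamBP L a M ρ k m j,
      ∑ x ∈ blockSites (L ^ j) (c.1 + e c.2), lam x = ∑ x ∈ blockSites (L ^ j) c.1, lam x := by
    intro j hj c hc
    have h := hdata j hj c hc
    rw [hφeq, linCovIter_one_grad hL hη hΛ j c.1 c.2, smul_eq_zero, mul_eq_zero] at h
    rcases h with h | h | h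
    · exact absurd h (inv_ne_zero (pow_ne_zero _ (by exact_mod_cast (show L ≠ 0 by omega))))
    · exact absurd h Complex.I_ne_zero
    · exact sub_eq_zero.1 h
  have hQ := blockSum_eq_zero_of_classData hd1 hL a M ρ hmk hlam_out hdata'
  -- (iii′) hence `λ̄ ∈ N(Q′)`: zero on `Λ′₀`, zero block sums on `Λs m j`, `1 ≤ j ≤ m`
  have h0 : ∀ x ∈ cubeLamS L a M ρ k m 0, conj (lam x) = 0 := by
    intro x hx
    rw [cubeLamS_of_lt L a M ρ k (show 0 < m by omega)] at hx
    have hx' : ¬ InBox (inLo L a ρ k 0) (inHi L a M ρ k 0) x := hx.2 (by omega)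
    have := hQ 0 (Nat.zero_le m) x (fun _ => hx')
    rw [pow_zero, sum_blockSites_one] at this
    rw [this, map_zero]
  have hQ' : ∀ j, 1 ≤ j → j ≤ m → ∀ y ∈ cubeLamS L a M ρ k m j, ∑ x ∈ blockSites (L ^ j) y, conj (lam x) = 0 := by
    intro j hj1 hjm y hy
    rw [← map_sum, hQ j hjm y fun hlt => ?_, map_zero]
    rw [cubeLamS_of_lt L a M ρ k hlt] at hy
    exact hy.2 (by omega)
  -- (iv) the Landau pairing with `λ̄`: `Σ_{□₀} |Δλ|² = 0`
  have hpair := pairing_covLap_eq_zero_of_isLandau138 hL hΩfin hLan (lam := fun x => conj (lam x))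
    (fun x hx => by rw [hlam_out x (by rwa [cubeFam_false_zero] at hx), map_zero]) h0 hQ'
  have hdiv : covDivB η (1 : Site d → Fin d → ℂˣ) φ = covLap η (1 : Site d → Fin d → ℂˣ) lam := by
    rw [hφeq]; rfl
  rw [hdiv] at hpair
  simp_rw [covLap_flat_conj] at hpair
  set w : Site d → ℂ := (cubeFam false L a M ρ k 0).indicator (covLap η (1 : Site d → Fin d → ℂˣ) lam) with hw
  have hwfin : (Function.support w).Finite := hΩfin.subset Set.support_indicator_subset
  have hww : ∑ᶠ x, conj (w x) * w x = 0 := by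
    rw [← hpair]
    refine finsum_congr fun x => ?_
    by_cases hx : x ∈ cubeFam false L a M ρ k 0
    · rw [hw, Set.indicator_of_mem hx]
    · rw [hw, Set.indicator_of_notMem hx, mul_zero, mul_zero]
  have hw0 : w = 0 := eq_zero_of_finsum_conj_mul_self_eq_zero hwfin hww
  have hharm : ∀ x ∈ cube L a M ρ k 0, covLap η (1 : Site d → Fin d → ℂˣ) lam x = 0 := by
    intro x hx
    have := congrFun hw0 x
    rwa [hw, Set.indicator_of_mem (by rwa [cubeFam_false_zero]), Pi.zero_apply] at this
  -- (v) Dirichlet energy: `λ` is translation invariant, hence zero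
  have hDir : ∑ᶠ x, conj (lam x) * covLap η (1 : Site d → Fin d → ℂˣ) lam x = 0 := by
    have : ∀ x, conj (lam x) * covLap η (1 : Site d → Fin d → ℂˣ) lam x = 0 := by
      intro x
      by_cases hx : x ∈ cube L a M ρ k 0
      · rw [hharm x hx, mul_zero]
      · rw [hlam_out x hx, map_zero, zero_mul]
    simp_rw [this]; exact finsum_zero
  have hshift := shift_eq_of_finsum_conj_mul_covLap_self_eq_zero hη.ne' hlamfin hDir
  have hlam : ∀ x, lam x = 0 := by
    intro x
    set i₀ : Fin d := ⟨0, by omega⟩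
    have hall : ∀ t : ℕ, lam (x + (t : ℤ) • e i₀) = lam x := by
      intro t
      induction t with
      | zero => simp
      | succ t ih => rw [show x + ((t + 1 : ℕ) : ℤ) • e i₀ = x + (t : ℤ) • e i₀ + e i₀ by
          push_cast; rw [add_smul, one_smul, add_assoc], hshift, ih]
    set n : ℕ := (hi i₀ + 1 - x i₀).toNat with hn
    rw [← hall n]
    refine hlam0 _ (not_inBox_of_hi_lt (i := i₀) ?_)
    rw [add_zsmul_e_apply, if_pos rfl, hn]
    simp only [Int.toNat_eq_max]
    rcases le_or_gt (hi i₀ + 1 - x i₀) 0 with h | h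
    · rw [max_eq_right h]; omega
    · rw [max_eq_left h.le]; omega
  funext y τ
  rw [hφeq]
  simp only [covDerivFwd_flat_apply, hlam, sub_zero, smul_zero, Pi.zero_apply]

#print axioms eq_zero_of_ineq159FlatData_eq_zero

end Literature.MathematicalPhysics.QuantumFieldTheory.Balaban1983to89.B8Ineq159FlatCubeMemberKernel

end
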